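/-
Copyright (c) 2026 The decomp-a2c cell. All rights reserved.
Released under Apache 2.0 license as described in the file LICENSE.
-/
import Summits.AtomisticToContinuum.Crystallization.Theorems.ChartedZeroExcessLayeredLatticeLiouvilleWK

/-!
# ChartedZeroExcessLayeredLatticeLiouville — part WL «PathSum»: lattice path sums (pointwise step bounds ⟹ linear growth from the centre) and the
  IN-PLANE BONDS of the modulus brick (decomp-a2c-lens-2, g58; helper of stmt-AtomisticToContinuum-26636, leaf (LD′) `ModalLipschitzZ`; brick (4a)
  `ModalLipschitzAt`, step (WL) of the g58 plan)

(4a) compares a harmonic field `φ` with an affine MODE `M` along unit bonds `X ~ Y` of the half ball, with the admissible growth `(dist X x₀ + 1)`.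
For an IN-PLANE bond in direction `E` the mode contributes the constant slope, so the quantity is `D_E φ(X) − D_E φ(x₀)`: a sum, along the
corner path `x₀ → (x₀.1, X.2) → X` (first up the central column, then inside the layer of `X`), of SECOND differences — vertical×in-plane ones on
the column (part WK `gap_gradient_sq_le`) and in-plane×in-plane ones in the layer (part WA/WF `norm_hessian_le_sqrt`), each `≲ √(E/#ball)/n`.

* WL.1–2: the discrete fundamental theorem along index walks (`norm_sub_le_of_steps`), in VE's chart (`chart_inPlane_walk`, `chart_corner_walk`)
  and on the lattice (`corner_walk`: `‖f X − f x₀‖ ≤ |ΔX₁| δ₁ + |ΔX₂| δ₂ + |ΔX₃| δ₃` from in-plane step bounds on the ball and vertical step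
  bounds on the central column; `inPlane_walk` for two sites of one layer).
* WL.3: ★ `inPlane_bond_sq_le`: `n² · #(idxBall x₀ n) · ‖D_E φ(X) − D_E φ(x₀)‖² ≤ ipConst · dist(X, x₀)² · E(φ; idxBall x₀ n)` for every
  `X ∈ idxBall x₀ (n/4)` and every in-plane unit step `E`, with a `ϱ`-free constant `ipConst`.
What then remains of (4a) is the VERTICAL bonds: `D₃φ(γ,α) − D₃φ(γ₀,α)` is `inPlane_walk` + WK again, and `D₃φ(γ₀,α) − (cf(α+1) − cf α)` is
the profile comparison along the central column (memo NODE-g58d).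
-/

namespace Summit.AtomisticToContinuum.Crystallization.Theorems.ChartedZeroExcessLayeredLatticeLiouville

open Summit.AtomisticToContinuum.Crystallization.Theorems.ChartedPlanarOrderRigidityDoor (E3)
open Finset
open scoped InnerProductSpace RealInnerProductSpace BigOperators

noncomputable section PathSum

variable {c : ℝ} {a b : E3} {w : ℤ → E3}

/-! ### WL.1  Walks in the chart -/

/-- the discrete fundamental theorem of calculus along an index walk: steps `≤ δ` on `[0, N]` give `‖u i − u j‖ ≤ |i − j| δ`.
[formal bookkeeping] -/
theorem norm_sub_le_of_steps (u : ℕ → E3) {N : ℕ} {δ : ℝ} (h : ∀ i < N, ‖u (i + 1) - u i‖ ≤ δ) {i j : ℕ} (hi : i ≤ N) (hj : j ≤ N) :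
    ‖u i - u j‖ ≤ |((i : ℝ)) - j| * δ := by
  wlog hij : j ≤ i generalizing i j
  · rw [norm_sub_rev, abs_sub_comm]
    exact this hj hi (le_of_not_ge hij)
  obtain ⟨m, rfl⟩ := Nat.exists_eq_add_of_le hij
  have ht := Finset.sum_range_sub (fun t => u (j + t)) m
  simp only [add_zero] at ht
  have hm : |(((j + m : ℕ)) : ℝ) - j| = m := by
    push_cast
    rw [show (j : ℝ) + m - j = m by ring]
    exact abs_of_nonneg (Nat.cast_nonneg m)
  rw [← ht, hm]
  calc ‖∑ t ∈ range m, (u (j + (t + 1)) - u (j + t))‖ ≤ ∑ t ∈ range m, ‖u (j + (t + 1)) - u (j + t)‖ := norm_sum_le _ _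
    _ ≤ ∑ _t ∈ range m, δ := sum_le_sum fun t hts => by
        rw [show j + (t + 1) = j + t + 1 by ring]
        exact h (j + t) (by have := mem_range.mp hts; omega)
    _ = m * δ := by rw [sum_const, card_range, nsmul_eq_mul]

/-- a walk inside one level `k` of a box function: `‖h i j k − h i' j' k‖ ≤ |i − i'| δ₁ + |j − j'| δ₂` from the in-plane step bounds.
[formal bookkeeping] -/
theorem chart_inPlane_walk (h : ℕ → ℕ → ℕ → E3) {N : ℕ} (k : ℕ) {δ₁ δ₂ : ℝ} (h₁ : ∀ i j, i < N → j ≤ N → ‖h (i + 1) j k - h i j k‖ ≤ δ₁)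
    (h₂ : ∀ i j, i ≤ N → j < N → ‖h i (j + 1) k - h i j k‖ ≤ δ₂) {i j i' j' : ℕ} (hi : i ≤ N) (hj : j ≤ N) (hi' : i' ≤ N) (hj' : j' ≤ N) :
    ‖h i j k - h i' j' k‖ ≤ |((i : ℝ)) - i'| * δ₁ + |((j : ℝ)) - j'| * δ₂ := by
  have e : h i j k - h i' j' k = (h i j k - h i' j k) + (h i' j k - h i' j' k) := by abel
  have b1 := norm_sub_le_of_steps (fun t => h t j k) (fun t ht => h₁ t j ht hj) hi hi'
  have b2 := norm_sub_le_of_steps (fun t => h i' t k) (fun t ht => h₂ i' t hi' ht) hj hj'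
  rw [e]
  exact (norm_add_le _ _).trans (add_le_add b1 b2)

/-- the corner walk of a box function from the centre `(R, R, R)`: up the central column, then inside the level. [formal bookkeeping] -/
theorem chart_corner_walk (h : ℕ → ℕ → ℕ → E3) {R : ℕ} {δ₁ δ₂ δ₃ : ℝ}
    (h₁ : ∀ i j k, i < 2 * R → j ≤ 2 * R → k ≤ 2 * R → ‖h (i + 1) j k - h i j k‖ ≤ δ₁)
    (h₂ : ∀ i j k, i ≤ 2 * R → j < 2 * R → k ≤ 2 * R → ‖h i (j + 1) k - h i j k‖ ≤ δ₂) (h₃ : ∀ k, k < 2 * R → ‖h R R (k + 1) - h R R k‖ ≤ δ₃)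
    {i j k : ℕ} (hi : i ≤ 2 * R) (hj : j ≤ 2 * R) (hk : k ≤ 2 * R) :
    ‖h i j k - h R R R‖ ≤ |((i : ℝ)) - R| * δ₁ + |((j : ℝ)) - R| * δ₂ + |((k : ℝ)) - R| * δ₃ := by
  have e : h i j k - h R R R = (h i j k - h R R k) + (h R R k - h R R R) := by abel
  have b1 := chart_inPlane_walk h k (fun i' j' hi' hj' => h₁ i' j' k hi' hj' hk) (fun i' j' hi' hj' => h₂ i' j' k hi' hj' hk) hi hj
    (by omega : R ≤ 2 * R) (by omega : R ≤ 2 * R)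
  have b2 := norm_sub_le_of_steps (fun t => h R R t) (fun t ht => h₃ t ht) hk (by omega : R ≤ 2 * R)
  rw [e]
  exact (norm_add_le _ _).trans (add_le_add b1 b2)

/-! ### WL.2  Walks on the lattice -/

/-- the centre of the chart. [formal bookkeeping] -/
theorem cubePt_center (x₀ : Cell 2 × ℤ) (R : ℕ) : cubePt x₀ R R R R = x₀ := by
  simp [cubePt]

/-- ★ CORNER WALK: in-plane step bounds `δ₁, δ₂` on the ball and a vertical step bound `δ₃` on the central column give
`‖f X − f x₀‖ ≤ |(X − x₀)₁| δ₁ + |(X − x₀)₂| δ₂ + |(X − x₀)₃| δ₃` for every `X` of the ball. [this file, g58] -/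
theorem corner_walk (f : Cell 2 → ℤ → E3) (x₀ : Cell 2 × ℤ) {r : ℝ} (hr : 0 ≤ r) {δ₁ δ₂ δ₃ : ℝ}
    (h₁ : ∀ Z ∈ idxBallF x₀ r, Z + idxAxis₁ ∈ idxBallF x₀ r → ‖latDiff idxAxis₁ f Z.1 Z.2‖ ≤ δ₁)
    (h₂ : ∀ Z ∈ idxBallF x₀ r, Z + idxAxis₂ ∈ idxBallF x₀ r → ‖latDiff idxAxis₂ f Z.1 Z.2‖ ≤ δ₂)
    (h₃ : ∀ Z ∈ idxBallF x₀ r, Z + idxAxis₃ ∈ idxBallF x₀ r → Z.1 = x₀.1 → ‖latDiff idxAxis₃ f Z.1 Z.2‖ ≤ δ₃) {X : Cell 2 × ℤ}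
    (hX : X ∈ idxBallF x₀ r) :
    ‖f X.1 X.2 - f x₀.1 x₀.2‖ ≤
      ((((X - x₀).1 0).natAbs : ℕ) : ℝ) * δ₁ + ((((X - x₀).1 1).natAbs : ℕ) : ℝ) * δ₂ + ((((X - x₀).2).natAbs : ℕ) : ℝ) * δ₃ := by
  obtain ⟨i, j, k, hi, hj, hk, rfl⟩ := exists_cubePt_eq hX
  set R : ℕ := ⌊r⌋₊ with hRdef
  set hc : ℕ → ℕ → ℕ → E3 := fun i' j' k' => f (cubePt x₀ R i' j' k').1 (cubePt x₀ R i' j' k').2 with hcdef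
  have s₁ : ∀ i' j' k', i' < 2 * R → j' ≤ 2 * R → k' ≤ 2 * R → ‖hc (i' + 1) j' k' - hc i' j' k'‖ ≤ δ₁ := by
    intro i' j' k' hi' hj' hk'
    have e : hc (i' + 1) j' k' - hc i' j' k' = latDiff idxAxis₁ f (cubePt x₀ R i' j' k').1 (cubePt x₀ R i' j' k').2 :=
      congrFun (congrFun (congrFun (fd₁_chart f x₀ R) i') j') k'
    rw [e]
    exact h₁ _ (cubePt_mem x₀ hr hi'.le hj' hk') (by rw [← cubePt_succ₁]; exact cubePt_mem x₀ hr (by omega) hj' hk')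
  have s₂ : ∀ i' j' k', i' ≤ 2 * R → j' < 2 * R → k' ≤ 2 * R → ‖hc i' (j' + 1) k' - hc i' j' k'‖ ≤ δ₂ := by
    intro i' j' k' hi' hj' hk'
    have e : hc i' (j' + 1) k' - hc i' j' k' = latDiff idxAxis₂ f (cubePt x₀ R i' j' k').1 (cubePt x₀ R i' j' k').2 :=
      congrFun (congrFun (congrFun (fd₂_chart f x₀ R) i') j') k'
    rw [e]
    exact h₂ _ (cubePt_mem x₀ hr hi' hj'.le hk') (by rw [← cubePt_succ₂]; exact cubePt_mem x₀ hr hi' (by omega) hk')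
  have s₃ : ∀ k', k' < 2 * R → ‖hc R R (k' + 1) - hc R R k'‖ ≤ δ₃ := by
    intro k' hk'
    have e : hc R R (k' + 1) - hc R R k' = latDiff idxAxis₃ f (cubePt x₀ R R R k').1 (cubePt x₀ R R R k').2 :=
      congrFun (congrFun (congrFun (fd₃_chart f x₀ R) R) R) k'
    rw [e]
    refine h₃ _ (cubePt_mem x₀ hr (by omega) (by omega) hk'.le) (by rw [← cubePt_succ₃]; exact cubePt_mem x₀ hr (by omega) (by omega) (by omega)) ?_
    have h0 := cubePt_sub_fst_zero x₀ R R R k'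
    have h1 := cubePt_sub_fst_one x₀ R R R k'
    rw [Prod.fst_sub, Pi.sub_apply, sub_self, sub_eq_zero] at h0 h1
    exact funext (Fin.forall_fin_two.mpr ⟨h0, h1⟩)
  have hw := chart_corner_walk hc s₁ s₂ s₃ hi hj hk
  have ec : hc R R R = f x₀.1 x₀.2 := by
    show f (cubePt x₀ R R R R).1 (cubePt x₀ R R R R).2 = f x₀.1 x₀.2
    rw [cubePt_center]
  rw [ec] at hw
  rw [cubePt_sub_fst_zero, cubePt_sub_fst_one, cubePt_sub_snd, Nat.cast_natAbs, Nat.cast_natAbs, Nat.cast_natAbs, Int.cast_abs, Int.cast_abs,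
    Int.cast_abs]
  push_cast
  exact hw

/-- the corner walk measured in the index norm: `‖f X − f x₀‖ ≤ idxNorm (X − x₀) · (δ₁ + δ₂ + δ₃)`. [this file, g58] -/
theorem corner_walk_idxNorm (f : Cell 2 → ℤ → E3) (x₀ : Cell 2 × ℤ) {r : ℝ} (hr : 0 ≤ r) {δ₁ δ₂ δ₃ : ℝ} (hδ₁ : 0 ≤ δ₁) (hδ₂ : 0 ≤ δ₂)
    (hδ₃ : 0 ≤ δ₃) (h₁ : ∀ Z ∈ idxBallF x₀ r, Z + idxAxis₁ ∈ idxBallF x₀ r → ‖latDiff idxAxis₁ f Z.1 Z.2‖ ≤ δ₁)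
    (h₂ : ∀ Z ∈ idxBallF x₀ r, Z + idxAxis₂ ∈ idxBallF x₀ r → ‖latDiff idxAxis₂ f Z.1 Z.2‖ ≤ δ₂)
    (h₃ : ∀ Z ∈ idxBallF x₀ r, Z + idxAxis₃ ∈ idxBallF x₀ r → Z.1 = x₀.1 → ‖latDiff idxAxis₃ f Z.1 Z.2‖ ≤ δ₃) {X : Cell 2 × ℤ}
    (hX : X ∈ idxBallF x₀ r) : ‖f X.1 X.2 - f x₀.1 x₀.2‖ ≤ (idxNorm (X - x₀) : ℝ) * (δ₁ + δ₂ + δ₃) := by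
  have hw := corner_walk f x₀ hr h₁ h₂ h₃ hX
  have a0 : ((((X - x₀).1 0).natAbs : ℕ) : ℝ) ≤ idxNorm (X - x₀) := by exact_mod_cast natAbs_fst_le_idxNorm (X - x₀) 0
  have a1 : ((((X - x₀).1 1).natAbs : ℕ) : ℝ) ≤ idxNorm (X - x₀) := by exact_mod_cast natAbs_fst_le_idxNorm (X - x₀) 1
  have a2 : ((((X - x₀).2).natAbs : ℕ) : ℝ) ≤ idxNorm (X - x₀) := by exact_mod_cast natAbs_snd_le_idxNorm (X - x₀)
  have b0 := mul_le_mul_of_nonneg_right a0 hδ₁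
  have b1 := mul_le_mul_of_nonneg_right a1 hδ₂
  have b2 := mul_le_mul_of_nonneg_right a2 hδ₃
  linarith

/-- IN-LAYER WALK between two sites of one layer of the ball: `‖f X − f Y‖ ≤ |(X − Y)₁| δ₁ + |(X − Y)₂| δ₂` from the in-plane step bounds
(used for the vertical bonds with `f = D₃ φ`, whose in-plane steps are WK's gap gradients). [this file, g58] -/
theorem inPlane_walk (f : Cell 2 → ℤ → E3) (x₀ : Cell 2 × ℤ) {r : ℝ} (hr : 0 ≤ r) {δ₁ δ₂ : ℝ}
    (h₁ : ∀ Z ∈ idxBallF x₀ r, Z + idxAxis₁ ∈ idxBallF x₀ r → ‖latDiff idxAxis₁ f Z.1 Z.2‖ ≤ δ₁)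
    (h₂ : ∀ Z ∈ idxBallF x₀ r, Z + idxAxis₂ ∈ idxBallF x₀ r → ‖latDiff idxAxis₂ f Z.1 Z.2‖ ≤ δ₂) {X Y : Cell 2 × ℤ}
    (hX : X ∈ idxBallF x₀ r) (hY : Y ∈ idxBallF x₀ r) (hXY : X.2 = Y.2) :
    ‖f X.1 X.2 - f Y.1 Y.2‖ ≤ ((((X.1 - Y.1) 0).natAbs : ℕ) : ℝ) * δ₁ + ((((X.1 - Y.1) 1).natAbs : ℕ) : ℝ) * δ₂ := by
  obtain ⟨i, j, k, hi, hj, hk, rfl⟩ := exists_cubePt_eq hX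
  obtain ⟨i', j', k', hi', hj', hk', rfl⟩ := exists_cubePt_eq hY
  set R : ℕ := ⌊r⌋₊ with hRdef
  have hkk : k = k' := by
    have e1 := cubePt_sub_snd x₀ R i j k
    have e2 := cubePt_sub_snd x₀ R i' j' k'
    rw [Prod.snd_sub] at e1 e2
    omega
  subst hkk
  set hc : ℕ → ℕ → ℕ → E3 := fun i' j' k' => f (cubePt x₀ R i' j' k').1 (cubePt x₀ R i' j' k').2 with hcdef
  have s₁ : ∀ a d, a < 2 * R → d ≤ 2 * R → ‖hc (a + 1) d k - hc a d k‖ ≤ δ₁ := by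
    intro a d ha hd
    have e : hc (a + 1) d k - hc a d k = latDiff idxAxis₁ f (cubePt x₀ R a d k).1 (cubePt x₀ R a d k).2 :=
      congrFun (congrFun (congrFun (fd₁_chart f x₀ R) a) d) k
    rw [e]
    exact h₁ _ (cubePt_mem x₀ hr ha.le hd hk) (by rw [← cubePt_succ₁]; exact cubePt_mem x₀ hr (by omega) hd hk)
  have s₂ : ∀ a d, a ≤ 2 * R → d < 2 * R → ‖hc a (d + 1) k - hc a d k‖ ≤ δ₂ := by
    intro a d ha hd
    have e : hc a (d + 1) k - hc a d k = latDiff idxAxis₂ f (cubePt x₀ R a d k).1 (cubePt x₀ R a d k).2 :=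
      congrFun (congrFun (congrFun (fd₂_chart f x₀ R) a) d) k
    rw [e]
    exact h₂ _ (cubePt_mem x₀ hr ha hd.le hk) (by rw [← cubePt_succ₂]; exact cubePt_mem x₀ hr ha (by omega) hk)
  have hw := chart_inPlane_walk hc k s₁ s₂ hi hj hi' hj'
  have d0 : (((cubePt x₀ R i j k).1 - (cubePt x₀ R i' j' k).1) 0) = (i : ℤ) - i' := by
    have e1 := cubePt_sub_fst_zero x₀ R i j k
    have e2 := cubePt_sub_fst_zero x₀ R i' j' k
    rw [Prod.fst_sub, Pi.sub_apply] at e1 e2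
    rw [Pi.sub_apply]
    omega
  have d1 : (((cubePt x₀ R i j k).1 - (cubePt x₀ R i' j' k).1) 1) = (j : ℤ) - j' := by
    have e1 := cubePt_sub_fst_one x₀ R i j k
    have e2 := cubePt_sub_fst_one x₀ R i' j' k
    rw [Prod.fst_sub, Pi.sub_apply] at e1 e2
    rw [Pi.sub_apply]
    omega
  rw [d0, d1, Nat.cast_natAbs, Nat.cast_natAbs, Int.cast_abs, Int.cast_abs]
  push_cast
  exact hw

/-! ### WL.3  ★ The in-plane bonds of (4a) -/

/-- WK solved for the norm: the vertical step of `D_E ψ` at a site of the half ball is `≤ √(gradConst · E/(n² · #ball))`. [this file, g58] -/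
theorem norm_gap_le_sqrt (hc : 0 < c) (hL : IsLayeredCrystal c a b w) {κ₀ ε ϱ : ℝ} (hκ₀ : 0 < κ₀) (hϱ : 0 ≤ ϱ) (hε : ε < 2 * κ₀)
    (hK : CoerciveZ (layeredKernel a b w) κ₀)
    (hT : ∀ φ : Cell 2 → ℤ → E3, HasFiniteSupport φ → Summable (tailFam ϱ a b w φ) ∧ ∑' x, tailFam ϱ a b w φ x ≤ ε * nnFormZ φ)
    (hP : ∀ E₀ : Cell 2 × ℤ, E₀.2 = 0 → (idxNorm E₀ : ℝ) ≤ 1 → ∀ (y₀ : Cell 2 × ℤ) (r' n' : ℝ), r' < n' → ∀ χ : Cell 2 → ℤ → E3,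
      IsTruncHarmonicZ ϱ a b w χ (idxBall y₀ (n' + 1)) →
        κ₀ * idxEnergy (latDiff E₀ χ) (idxBall y₀ r') ≤ 54 * kernelConst c * ((n' - r')⁻¹) ^ 2 * idxEnergy χ (idxBall y₀ (n' + ϱ / c + 1)))
    (x₀ : Cell 2 × ℤ) {n : ℝ} (hn : 256 * (ϱ / c + 2) ≤ n) (hn3 : 2 ^ 25 * (ϱ / c) ≤ n ^ 3) {ψ : Cell 2 → ℤ → E3}
    (hψ : IsTruncHarmonicZ ϱ a b w ψ (idxBall x₀ n)) {E : Cell 2 × ℤ} (hE : E.2 = 0) (hE1 : (idxNorm E : ℝ) ≤ 1) {Z : Cell 2 × ℤ}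
    (hZ : Z ∈ idxBall x₀ (n / 2)) :
    ‖latDiff idxAxis₃ (latDiff E ψ) Z.1 Z.2‖ ≤ Real.sqrt (gradConst c κ₀ ε * idxEnergy ψ (idxBall x₀ n) / (n ^ 2 * (idxBall x₀ n).ncard)) := by
  have h := gap_gradient_sq_le hc hL hκ₀ hϱ hε hK hT hP x₀ hn hn3 hψ hE hE1 Z.1 Z.2 hZ
  have hn0 : 0 < n := by have := div_nonneg hϱ hc.le; linarith
  have hN := ncard_idxBall_pos x₀ hn0.le
  rw [latDiff_axis₃_apply]
  have h2 : ‖latDiff E ψ Z.1 (Z.2 + 1) - latDiff E ψ Z.1 Z.2‖ ^ 2 ≤ gradConst c κ₀ ε * idxEnergy ψ (idxBall x₀ n) / (n ^ 2 * (idxBall x₀ n).ncard) := by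
    rw [le_div_iff₀ (by positivity)]
    calc ‖latDiff E ψ Z.1 (Z.2 + 1) - latDiff E ψ Z.1 Z.2‖ ^ 2 * (n ^ 2 * ((idxBall x₀ n).ncard : ℝ))
        = n ^ 2 * ((idxBall x₀ n).ncard : ℝ) * ‖latDiff E ψ Z.1 (Z.2 + 1) - latDiff E ψ Z.1 Z.2‖ ^ 2 := by ring
      _ ≤ _ := h
  have h3 := Real.abs_le_sqrt h2
  rwa [abs_norm] at h3

/-- the constant of the in-plane bonds: `8 ·` the in-plane Hessian constant `+ 2 · gradConst`. -/
def ipConst (c κ₀ ε : ℝ) : ℝ := 8 * (6912 * (54 * kernelConst c / κ₀) * lipConst c κ₀) + 2 * gradConst c κ₀ ε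

/-- ★ IN-PLANE BONDS OF (4a): for `φ` harmonic on `idxBall x₀ n` (`n ≥ 256(ϱ/c+2)`, `n³ ≥ 2²⁵ϱ/c`), an in-plane unit step `E` and every
`X ∈ idxBall x₀ (n/4)`: `n² · #(idxBall x₀ n) · ‖D_E φ(X) − D_E φ(x₀)‖² ≤ ipConst · dist(X, x₀)² · E(φ; idxBall x₀ n)` — the in-plane slope of a
harmonic field drifts from its central value at most linearly, at the rate `√(E/#ball)/n` (corner walk: WK on the central column, WA/WF in the layer).
[this file, g58] -/
theorem inPlane_bond_sq_le (hc : 0 < c) (hL : IsLayeredCrystal c a b w) {κ₀ ε ϱ : ℝ} (hκ₀ : 0 < κ₀) (hϱ : 0 ≤ ϱ) (hε : ε < 2 * κ₀)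
    (hK : CoerciveZ (layeredKernel a b w) κ₀)
    (hT : ∀ φ : Cell 2 → ℤ → E3, HasFiniteSupport φ → Summable (tailFam ϱ a b w φ) ∧ ∑' x, tailFam ϱ a b w φ x ≤ ε * nnFormZ φ)
    (hP : ∀ E₀ : Cell 2 × ℤ, E₀.2 = 0 → (idxNorm E₀ : ℝ) ≤ 1 → ∀ (y₀ : Cell 2 × ℤ) (r' n' : ℝ), r' < n' → ∀ χ : Cell 2 → ℤ → E3,
      IsTruncHarmonicZ ϱ a b w χ (idxBall y₀ (n' + 1)) →
        κ₀ * idxEnergy (latDiff E₀ χ) (idxBall y₀ r') ≤ 54 * kernelConst c * ((n' - r')⁻¹) ^ 2 * idxEnergy χ (idxBall y₀ (n' + ϱ / c + 1)))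
    (x₀ : Cell 2 × ℤ) {n : ℝ} (hn : 256 * (ϱ / c + 2) ≤ n) (hn3 : 2 ^ 25 * (ϱ / c) ≤ n ^ 3) {φ : Cell 2 → ℤ → E3}
    (hφ : IsTruncHarmonicZ ϱ a b w φ (idxBall x₀ n)) {E : Cell 2 × ℤ} (hE : E.2 = 0) (hE1 : (idxNorm E : ℝ) ≤ 1) {X : Cell 2 × ℤ}
    (hX : X ∈ idxBall x₀ (n / 4)) :
    n ^ 2 * ((idxBall x₀ n).ncard : ℝ) * ‖latDiff E φ X.1 X.2 - latDiff E φ x₀.1 x₀.2‖ ^ 2 ≤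
      ipConst c κ₀ ε * dist X x₀ ^ 2 * idxEnergy φ (idxBall x₀ n) := by
  have hϱc : 0 ≤ ϱ / c := div_nonneg hϱ hc.le
  have hn0 : 0 < n := by linarith
  have hn32 : 32 * (ϱ / c + 2) ≤ n := by linarith
  have hN := ncard_idxBall_pos x₀ hn0.le
  set H : ℝ := 6912 * (54 * kernelConst c / κ₀) * lipConst c κ₀ * idxEnergy φ (idxBall x₀ n) / (n ^ 2 * (idxBall x₀ n).ncard) with hHdef
  set G : ℝ := gradConst c κ₀ ε * idxEnergy φ (idxBall x₀ n) / (n ^ 2 * (idxBall x₀ n).ncard) with hGdef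
  have hF := kernelConst_nonneg hc
  have hlip := zero_le_one.trans (one_le_lipConst hc hκ₀)
  have hE0 := idxEnergy_nonneg φ (idxBall x₀ n)
  have hH0 : 0 ≤ H := by positivity
  have hG0 : 0 ≤ G := by
    have h1 := gap_gradient_sq_le hc hL hκ₀ hϱ hε hK hT hP x₀ hn hn3 hφ hE hE1 x₀.1 x₀.2
      (show dist (x₀.1, x₀.2) x₀ ≤ n / 2 by rw [Prod.mk.eta, dist_self]; positivity)
    have h2 : 0 ≤ gradConst c κ₀ ε * idxEnergy φ (idxBall x₀ n) :=
      le_trans (by positivity) h1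
    positivity
  have hXF : X ∈ idxBallF x₀ (n / 4) := by rw [← mem_coe, coe_idxBallF]; exact hX
  have mem : ∀ Z ∈ idxBallF x₀ (n / 4), Z ∈ idxBall x₀ (n / 4) := fun Z hZ => by rw [← mem_coe, coe_idxBallF] at hZ; exact hZ
  have h₁ : ∀ Z ∈ idxBallF x₀ (n / 4), Z + idxAxis₁ ∈ idxBallF x₀ (n / 4) → ‖latDiff idxAxis₁ (latDiff E φ) Z.1 Z.2‖ ≤ Real.sqrt H :=
    fun Z hZ _ => norm_hessian_le_sqrt hc hκ₀ hϱ hP x₀ hn32 hφ idxAxis₁_snd idxNorm_idxAxis₁_le hE hE1 (mem Z hZ)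
  have h₂ : ∀ Z ∈ idxBallF x₀ (n / 4), Z + idxAxis₂ ∈ idxBallF x₀ (n / 4) → ‖latDiff idxAxis₂ (latDiff E φ) Z.1 Z.2‖ ≤ Real.sqrt H :=
    fun Z hZ _ => norm_hessian_le_sqrt hc hκ₀ hϱ hP x₀ hn32 hφ idxAxis₂_snd idxNorm_idxAxis₂_le hE hE1 (mem Z hZ)
  have h₃ : ∀ Z ∈ idxBallF x₀ (n / 4), Z + idxAxis₃ ∈ idxBallF x₀ (n / 4) → Z.1 = x₀.1 → ‖latDiff idxAxis₃ (latDiff E φ) Z.1 Z.2‖ ≤ Real.sqrt G :=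
    fun Z hZ _ _ => norm_gap_le_sqrt hc hL hκ₀ hϱ hε hK hT hP x₀ hn hn3 hφ hE hE1 (idxBall_mono x₀ (by linarith) (mem Z hZ))
  have hw := corner_walk_idxNorm (latDiff E φ) x₀ (by positivity : (0 : ℝ) ≤ n / 4) (Real.sqrt_nonneg H) (Real.sqrt_nonneg H) (Real.sqrt_nonneg G)
    h₁ h₂ h₃ hXF
  have hd : (idxNorm (X - x₀) : ℝ) = dist X x₀ := by rw [dist_comm, dist_eq_idxNorm]
  rw [hd] at hw
  have hsq : ‖latDiff E φ X.1 X.2 - latDiff E φ x₀.1 x₀.2‖ ^ 2 ≤ (dist X x₀ * (Real.sqrt H + Real.sqrt H + Real.sqrt G)) ^ 2 :=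
    pow_le_pow_left₀ (norm_nonneg _) hw 2
  have e3 : (Real.sqrt H + Real.sqrt H + Real.sqrt G) ^ 2 ≤ 8 * H + 2 * G := by
    have a := Real.sq_sqrt hH0
    have b := Real.sq_sqrt hG0
    nlinarith [sq_nonneg (2 * Real.sqrt H - Real.sqrt G), Real.sqrt_nonneg H, Real.sqrt_nonneg G]
  have e4 : n ^ 2 * ((idxBall x₀ n).ncard : ℝ) * (8 * H + 2 * G) = ipConst c κ₀ ε * idxEnergy φ (idxBall x₀ n) := by
    rw [hHdef, hGdef, ipConst]
    field_simp
  calc n ^ 2 * ((idxBall x₀ n).ncard : ℝ) * ‖latDiff E φ X.1 X.2 - latDiff E φ x₀.1 x₀.2‖ ^ 2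
      ≤ n ^ 2 * ((idxBall x₀ n).ncard : ℝ) * (dist X x₀ * (Real.sqrt H + Real.sqrt H + Real.sqrt G)) ^ 2 :=
        mul_le_mul_of_nonneg_left hsq (by positivity)
    _ = dist X x₀ ^ 2 * (n ^ 2 * ((idxBall x₀ n).ncard : ℝ) * (Real.sqrt H + Real.sqrt H + Real.sqrt G) ^ 2) := by ring
    _ ≤ dist X x₀ ^ 2 * (n ^ 2 * ((idxBall x₀ n).ncard : ℝ) * (8 * H + 2 * G)) :=
        mul_le_mul_of_nonneg_left (mul_le_mul_of_nonneg_left e3 (by positivity)) (sq_nonneg _)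
    _ = ipConst c κ₀ ε * dist X x₀ ^ 2 * idxEnergy φ (idxBall x₀ n) := by rw [e4]; ring

/-- ★ VERTICAL BONDS OF (4a), in-plane transport: for `φ` harmonic on `idxBall x₀ n` and `X ∈ idxBall x₀ (n/4)`, the vertical increment at `X`
differs from the one on the CENTRAL COLUMN at the same layer by `n² · #ball · ‖D₃φ(X) − D₃φ(x₀.1, X.2)‖² ≤ 4 · gradConst · dist(X, x₀)² · E`
(in-layer walk; the in-plane steps of `D₃ φ` are WK's gap gradients after commuting differences). [this file, g58] -/
theorem vertical_bond_inPlane_sq_le (hc : 0 < c) (hL : IsLayeredCrystal c a b w) {κ₀ ε ϱ : ℝ} (hκ₀ : 0 < κ₀) (hϱ : 0 ≤ ϱ) (hε : ε < 2 * κ₀)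
    (hK : CoerciveZ (layeredKernel a b w) κ₀)
    (hT : ∀ φ : Cell 2 → ℤ → E3, HasFiniteSupport φ → Summable (tailFam ϱ a b w φ) ∧ ∑' x, tailFam ϱ a b w φ x ≤ ε * nnFormZ φ)
    (hP : ∀ E₀ : Cell 2 × ℤ, E₀.2 = 0 → (idxNorm E₀ : ℝ) ≤ 1 → ∀ (y₀ : Cell 2 × ℤ) (r' n' : ℝ), r' < n' → ∀ χ : Cell 2 → ℤ → E3,
      IsTruncHarmonicZ ϱ a b w χ (idxBall y₀ (n' + 1)) →
        κ₀ * idxEnergy (latDiff E₀ χ) (idxBall y₀ r') ≤ 54 * kernelConst c * ((n' - r')⁻¹) ^ 2 * idxEnergy χ (idxBall y₀ (n' + ϱ / c + 1)))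
    (x₀ : Cell 2 × ℤ) {n : ℝ} (hn : 256 * (ϱ / c + 2) ≤ n) (hn3 : 2 ^ 25 * (ϱ / c) ≤ n ^ 3) {φ : Cell 2 → ℤ → E3}
    (hφ : IsTruncHarmonicZ ϱ a b w φ (idxBall x₀ n)) {X : Cell 2 × ℤ} (hX : X ∈ idxBall x₀ (n / 4)) :
    n ^ 2 * ((idxBall x₀ n).ncard : ℝ) * ‖latDiff idxAxis₃ φ X.1 X.2 - latDiff idxAxis₃ φ x₀.1 X.2‖ ^ 2 ≤
      4 * gradConst c κ₀ ε * dist X x₀ ^ 2 * idxEnergy φ (idxBall x₀ n) := by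
  have hϱc : 0 ≤ ϱ / c := div_nonneg hϱ hc.le
  have hn0 : 0 < n := by linarith
  have hN := ncard_idxBall_pos x₀ hn0.le
  set G : ℝ := gradConst c κ₀ ε * idxEnergy φ (idxBall x₀ n) / (n ^ 2 * (idxBall x₀ n).ncard) with hGdef
  have hXF : X ∈ idxBallF x₀ (n / 4) := by rw [← mem_coe, coe_idxBallF]; exact hX
  have mem : ∀ Z ∈ idxBallF x₀ (n / 4), Z ∈ idxBall x₀ (n / 2) := fun Z hZ => by
    rw [← mem_coe, coe_idxBallF] at hZ
    exact idxBall_mono x₀ (by linarith) hZ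
  have h₁ : ∀ Z ∈ idxBallF x₀ (n / 4), Z + idxAxis₁ ∈ idxBallF x₀ (n / 4) → ‖latDiff idxAxis₁ (latDiff idxAxis₃ φ) Z.1 Z.2‖ ≤ Real.sqrt G :=
    fun Z hZ _ => by
      rw [latDiff_latDiff_comm]
      exact norm_gap_le_sqrt hc hL hκ₀ hϱ hε hK hT hP x₀ hn hn3 hφ idxAxis₁_snd idxNorm_idxAxis₁_le (mem Z hZ)
  have h₂ : ∀ Z ∈ idxBallF x₀ (n / 4), Z + idxAxis₂ ∈ idxBallF x₀ (n / 4) → ‖latDiff idxAxis₂ (latDiff idxAxis₃ φ) Z.1 Z.2‖ ≤ Real.sqrt G :=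
    fun Z hZ _ => by
      rw [latDiff_latDiff_comm]
      exact norm_gap_le_sqrt hc hL hκ₀ hϱ hε hK hT hP x₀ hn hn3 hφ idxAxis₂_snd idxNorm_idxAxis₂_le (mem Z hZ)
  have hYn : (idxNorm ((x₀.1, X.2) - x₀) : ℝ) ≤ idxNorm (X - x₀) := by
    rw [show (x₀.1, X.2) - x₀ = (x₀.1 - x₀.1, X.2 - x₀.2) from rfl]
    exact_mod_cast idxNorm_mk_le (by simp) (by simp) (natAbs_snd_le_idxNorm (X - x₀))
  have hd : (idxNorm (X - x₀) : ℝ) = dist X x₀ := by rw [dist_comm, dist_eq_idxNorm]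
  have hYF : (x₀.1, X.2) ∈ idxBallF x₀ (n / 4) := by
    rw [mem_idxBallF_iff_idxNorm]
    have h4 : dist X x₀ ≤ n / 4 := hX
    linarith
  have hw := inPlane_walk (latDiff idxAxis₃ φ) x₀ (by positivity : (0 : ℝ) ≤ n / 4) h₁ h₂ hXF hYF rfl
  have a0 : ((((X.1 - x₀.1) 0).natAbs : ℕ) : ℝ) ≤ idxNorm (X - x₀) := by exact_mod_cast natAbs_fst_le_idxNorm (X - x₀) 0
  have a1 : ((((X.1 - x₀.1) 1).natAbs : ℕ) : ℝ) ≤ idxNorm (X - x₀) := by exact_mod_cast natAbs_fst_le_idxNorm (X - x₀) 1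
  rw [hd] at a0 a1
  have hG' := Real.sqrt_nonneg G
  have hw' : ‖latDiff idxAxis₃ φ X.1 X.2 - latDiff idxAxis₃ φ x₀.1 X.2‖ ≤ 2 * dist X x₀ * Real.sqrt G := by
    have b0 := mul_le_mul_of_nonneg_right a0 hG'
    have b1 := mul_le_mul_of_nonneg_right a1 hG'
    have hw2 : ‖latDiff idxAxis₃ φ X.1 X.2 - latDiff idxAxis₃ φ (x₀.1, X.2).1 (x₀.1, X.2).2‖ ≤
        ((((X.1 - (x₀.1, X.2).1) 0).natAbs : ℕ) : ℝ) * Real.sqrt G + ((((X.1 - (x₀.1, X.2).1) 1).natAbs : ℕ) : ℝ) * Real.sqrt G := hw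
    dsimp only at hw2
    linarith
  have hG0 : 0 ≤ G := by
    have h1 := gap_gradient_sq_le hc hL hκ₀ hϱ hε hK hT hP x₀ hn hn3 hφ idxAxis₁_snd idxNorm_idxAxis₁_le x₀.1 x₀.2
      (show dist (x₀.1, x₀.2) x₀ ≤ n / 2 by rw [Prod.mk.eta, dist_self]; positivity)
    have h2 : 0 ≤ gradConst c κ₀ ε * idxEnergy φ (idxBall x₀ n) := le_trans (by positivity) h1
    positivity
  have hsq : ‖latDiff idxAxis₃ φ X.1 X.2 - latDiff idxAxis₃ φ x₀.1 X.2‖ ^ 2 ≤ (2 * dist X x₀ * Real.sqrt G) ^ 2 :=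
    pow_le_pow_left₀ (norm_nonneg _) hw' 2
  have e3 : (2 * dist X x₀ * Real.sqrt G) ^ 2 = 4 * dist X x₀ ^ 2 * G := by rw [mul_pow, mul_pow, Real.sq_sqrt hG0]; ring
  have e4 : n ^ 2 * ((idxBall x₀ n).ncard : ℝ) * G = gradConst c κ₀ ε * idxEnergy φ (idxBall x₀ n) := by
    rw [hGdef]
    field_simp
  calc n ^ 2 * ((idxBall x₀ n).ncard : ℝ) * ‖latDiff idxAxis₃ φ X.1 X.2 - latDiff idxAxis₃ φ x₀.1 X.2‖ ^ 2
      ≤ n ^ 2 * ((idxBall x₀ n).ncard : ℝ) * (4 * dist X x₀ ^ 2 * G) := by rw [← e3]; exact mul_le_mul_of_nonneg_left hsq (by positivity)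
    _ = 4 * dist X x₀ ^ 2 * (n ^ 2 * ((idxBall x₀ n).ncard : ℝ) * G) := by ring
    _ = 4 * gradConst c κ₀ ε * dist X x₀ ^ 2 * idxEnergy φ (idxBall x₀ n) := by rw [e4]; ring

/-! ### WL.4  The closed statement of this part -/

/-- The content of part WL as one closed proposition: the in-plane bonds of the modulus brick (4a). -/
def PathSumShape : Prop :=
  ∀ c : ℝ, 0 < c → ∀ (a b : E3) (w : ℤ → E3), IsLayeredCrystal c a b w → ∀ κ₀ ε ϱ : ℝ, 0 < κ₀ → 0 ≤ ϱ → ε < 2 * κ₀ →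
    CoerciveZ (layeredKernel a b w) κ₀ →
    (∀ φ : Cell 2 → ℤ → E3, HasFiniteSupport φ → Summable (tailFam ϱ a b w φ) ∧ ∑' x, tailFam ϱ a b w φ x ≤ ε * nnFormZ φ) →
    (∀ E₀ : Cell 2 × ℤ, E₀.2 = 0 → (idxNorm E₀ : ℝ) ≤ 1 → ∀ (y₀ : Cell 2 × ℤ) (r' n' : ℝ), r' < n' → ∀ χ : Cell 2 → ℤ → E3,
      IsTruncHarmonicZ ϱ a b w χ (idxBall y₀ (n' + 1)) →
        κ₀ * idxEnergy (latDiff E₀ χ) (idxBall y₀ r') ≤ 54 * kernelConst c * ((n' - r')⁻¹) ^ 2 * idxEnergy χ (idxBall y₀ (n' + ϱ / c + 1))) →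
    ∀ (x₀ : Cell 2 × ℤ) (n : ℝ), 256 * (ϱ / c + 2) ≤ n → 2 ^ 25 * (ϱ / c) ≤ n ^ 3 → ∀ φ : Cell 2 → ℤ → E3,
      IsTruncHarmonicZ ϱ a b w φ (idxBall x₀ n) → ∀ E : Cell 2 × ℤ, E.2 = 0 → (idxNorm E : ℝ) ≤ 1 → ∀ X : Cell 2 × ℤ, X ∈ idxBall x₀ (n / 4) →
        n ^ 2 * ((idxBall x₀ n).ncard : ℝ) * ‖latDiff E φ X.1 X.2 - latDiff E φ x₀.1 x₀.2‖ ^ 2 ≤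
          ipConst c κ₀ ε * dist X x₀ ^ 2 * idxEnergy φ (idxBall x₀ n)

/-- WL holds. [this file, g58] -/
theorem pathSumShape_holds : PathSumShape :=
  fun _c hc _a _b _w hL _κ₀ _ε _ϱ hκ₀ hϱ hε hK hT hP x₀ _n hn hn3 _φ hφ _E hE hE1 _X hX =>
    inPlane_bond_sq_le hc hL hκ₀ hϱ hε hK hT hP x₀ hn hn3 hφ hE hE1 hX

end PathSum

end Summit.AtomisticToContinuum.Crystallization.Theorems.ChartedZeroExcessLayeredLatticeLiouville
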